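import Literature.MathematicalPhysics.QuantumFieldTheory.FiniteGaugeGroupTorus
import Literature.Probability.LatticeModels.PolymerGasGeometric
import Literature.Probability.LatticeModels.LatticeAnimals
import HarnessLib

/-!
# The contour (vortex) gas of an abelian lattice gauge theory on the torus

Support file for the low-temperature expansion of `ℤ_n` lattice gauge theory on the tori
`(ℤ/Lℤ)^d` (discharge of `Literature.Barriers.QuantumFields.ZnHiggsPhaseD4` through the torus core
facts of `DiscreteSubgroupFreezingProofs.lean`). For a finite abelian group `A` (additive
notation; `A = Additive G` for the gauge group `G`) a *plaquette configuration* is a function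
`η : Plaquette d L → A` on the genuine plaquettes of the torus; the Gibbs factor of a
configuration is the product `Wt φ η = ∏_p φ(η p)` of single-plaquette weights with `φ 0 = 1`
(for the Wilson action of `ℤ_n`, `φ(a) = e^{-β(1 - Re a)}`). The closed configurations
(`IsClosedPl`, no flux out of any `3`-cell — the image of the link configurations consists of
closed ones) decompose uniquely into their cube-connected components ("vortices"), each of which is
again closed (`AbelianTorusCochains.isClosedPl_restrictPl`), and the Gibbs factor as well as every
*multiplicative* observable factorises over the components. This file turns these facts into the
**polymer representation** of the closed-configuration sums,

  `∑_{η closed} Wt(η) ψ(η) = Ξ(Λ_L; z_ψ)`  (`sum_closed_eq_polymerPartitionFunction`),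

where the polymers are the cube-connected plaquette sets `X` with the geometric incompatibility
of `PolymerGasGeometric` (equal or touching) and the activity
`z_ψ(X) = ∑_{η closed, supp η = X} Wt(η) ψ(η)` (`act`), and records the inputs of the
Kotecký–Preiss machinery (`ClusterExpansion`): the activity bound `‖z_ψ X‖ ≤ (|A| ε)^{#X}` when
`φ ≤ ε` off `0` and `|ψ| ≤ 1` (`norm_act_le`), and the Kotecký–Preiss condition
`∑_{Y ι X} ‖z_ψ Y‖ e^{(1+τ)#Y} ≤ #X` for `|A| ε e^{1+τ}` small (`kp_act`, from the lattice-animal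
bound `sum_kpWeight_le_of_touches` and the degree bound `card_cubeNbr_le`). It also proves the
Peierls-type bound on the closed configurations possessing a large component
(`sum_closed_bigComponent_le`) and that closed configurations all of whose components are small
are plaquette fields of link configurations (`exists_plaqField_eq_of_small`; the components are
translated away from the seam and the torus Poincaré lemma `exists_td₁_eq_of_liftBox` applies).

## References

* R. Kotecký, D. Preiss, *Cluster expansion for abstract polymer models*, Comm. Math. Phys. 103
  (1986) 491–498 (the abstract polymer setting). [KoteckyPreiss1986]
* S. Friedli, Y. Velenik, *Statistical Mechanics of Lattice Systems* (2017), §5.2, §5.7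
  (polymer representations; Peierls contours). [FriedliVelenik2017]
* R. Marra, S. Miracle-Solé, Comm. Math. Phys. 67 (1979) 233 (low-temperature expansion of the
  gauge invariant Ising model). [MarraMiraclesole1979]
* M. P. Forsström, J. Lenells, F. Viklund, AIHP 58 (2022), arXiv:2001.07453: §5 (vortices; §5.2
  vortex decompositions, Lemma 5.3, p. 17) and §2.3.3 (Lemma 2.2, the Poincaré lemma, p. 10) — the
  numbering and pages of arXiv v4 (11 Nov 2021, the latest), used by all tags of this file (= §4,
  Lemma 4.3, p. 12 and §2.1.9, Lemma 2.1, p. 6 of arXiv v3). [ForsstromLenellsViklund2022]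
-/

noncomputable section

open Finset Function
open Literature.Probability.LatticeModels (IsRConnected Touches GeomInc rcomponent rcomponents
  polymerPartitionFunction IsCompatible)

namespace Literature.MathematicalPhysics.QuantumFieldTheory

namespace LatticeForm

variable {d L : ℕ} [NeZero L] {A : Type*} [AddCommGroup A] [Fintype A] [DecidableEq A]

/-! ### Decidability (classical) -/

/-- Cube adjacency is decidable (classically; every sum in this file is over a finite type, and
the instances only serve the `Finset.filter`/`if` bookkeeping). [folklore] -/
instance instDecidableRelCubeAdj : DecidableRel (CubeAdj (d := d) (L := L)) :=
  fun _ _ => Classical.propDecidable _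

/-- Closedness of a plaquette configuration is decidable (classically). [folklore] -/
instance instDecidablePredIsClosedPl : DecidablePred (IsClosedPl (d := d) (L := L) (A := A)) :=
  fun _ => Classical.propDecidable _

/-! ### Supports, fibres, Gibbs factors, activities -/

/-- The support of a plaquette configuration: the plaquettes carrying a non-zero value
("vortex plaquettes"). [folklore] -/
def psupp (η : Plaquette d L → A) : Finset (Plaquette d L) := Finset.univ.filter fun p => η p ≠ 0

omit [Fintype A] in
/-- Membership in the support. [folklore] -/
@[simp] theorem mem_psupp {η : Plaquette d L → A} {p : Plaquette d L} : p ∈ psupp η ↔ η p ≠ 0 := by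
  simp [psupp]

/-- The **fibre** over a plaquette set `X`: the closed configurations supported exactly on `X`.
[folklore] -/
def Fib (X : Finset (Plaquette d L)) : Finset (Plaquette d L → A) :=
  Finset.univ.filter fun η => IsClosedPl η ∧ psupp η = X

/-- Membership in a fibre. [folklore] -/
@[simp] theorem mem_Fib {X : Finset (Plaquette d L)} {η : Plaquette d L → A} :
    η ∈ Fib X ↔ IsClosedPl η ∧ psupp η = X := by
  simp [Fib]

/-- The finite set of all closed configurations. [folklore] -/
def Closed (d L : ℕ) [NeZero L] (A : Type*) [AddCommGroup A] [Fintype A] [DecidableEq A] :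
    Finset (Plaquette d L → A) :=
  Finset.univ.filter fun η => IsClosedPl η

/-- Membership in `Closed`. [folklore] -/
@[simp] theorem mem_Closed {η : Plaquette d L → A} : η ∈ Closed d L A ↔ IsClosedPl η := by
  simp [Closed]

/-- The Gibbs factor of a configuration: the product of the single-plaquette weights. [folklore] -/
def Wt (φ : A → ℝ) (η : Plaquette d L → A) : ℝ := ∏ p, φ (η p)

omit [Fintype A] in
/-- With `φ 0 = 1` the Gibbs factor is the product over the support. [folklore] -/
theorem Wt_eq_prod_psupp {φ : A → ℝ} (hφ0 : φ 0 = 1) (η : Plaquette d L → A) :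
    Wt φ η = ∏ p ∈ psupp η, φ (η p) := by
  unfold Wt
  rw [← Finset.prod_filter_mul_prod_filter_not Finset.univ (fun p => η p ≠ 0)]
  have : ∏ p ∈ Finset.univ.filter (fun p => ¬ η p ≠ 0), φ (η p) = 1 :=
    Finset.prod_eq_one fun p hp => by
      have : η p = 0 := by simpa using (Finset.mem_filter.1 hp).2
      rw [this, hφ0]
  rw [this, mul_one]
  rfl

/-- A *multiplicative observable* of plaquette configurations: `ψ 0 = 1` and `ψ` is
multiplicative over sums of configurations with disjoint supports. Examples: `1`; products over
a plaquette set `B` of one-site factors `a_p(η p)` with `a_p 0 = 1`; characters. [folklore] -/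
def IsMultObs (ψ : (Plaquette d L → A) → ℂ) : Prop :=
  ψ 0 = 1 ∧ ∀ η₁ η₂ : Plaquette d L → A, Disjoint (psupp η₁) (psupp η₂) → ψ (η₁ + η₂) = ψ η₁ * ψ η₂

/-- The **activity** of a plaquette set in the contour gas dressed by the observable `ψ`:
`z_ψ(X) = ∑_{η closed, supp η = X} Wt(η) ψ(η)` on cube-connected `X`, zero otherwise. [folklore] -/
def act (φ : A → ℝ) (ψ : (Plaquette d L → A) → ℂ) (X : Finset (Plaquette d L)) : ℂ :=
  by classical exact if IsRConnected CubeAdj X then ∑ η ∈ Fib X, (Wt φ η : ℂ) * ψ η else 0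

/-! ### Algebra of restrictions -/

omit [Fintype A] in
/-- Support of a sum of configurations with disjoint supports. [folklore] -/
theorem psupp_add_of_disjoint {η₁ η₂ : Plaquette d L → A} (h : Disjoint (psupp η₁) (psupp η₂)) :
    psupp (η₁ + η₂) = psupp η₁ ∪ psupp η₂ := by
  ext p
  simp only [mem_psupp, Finset.mem_union, Pi.add_apply]
  have h1 : η₁ p ≠ 0 → η₂ p = 0 := fun h1 => by
    by_contra h2
    exact Finset.disjoint_left.1 h (mem_psupp.2 h1) (mem_psupp.2 h2)
  have h2 : η₂ p ≠ 0 → η₁ p = 0 := fun h2 => by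
    by_contra h1'
    exact Finset.disjoint_left.1 h (mem_psupp.2 h1') (mem_psupp.2 h2)
  constructor
  · intro hp
    by_cases h1' : η₁ p = 0
    · right; rwa [h1', zero_add] at hp
    · exact Or.inl h1'
  · rintro (hp | hp)
    · rw [h1 hp, add_zero]; exact hp
    · rw [h2 hp, zero_add]; exact hp

omit [Fintype A] in
/-- The support of a restriction. [folklore] -/
theorem psupp_restrictPl (η : Plaquette d L → A) (X : Finset (Plaquette d L)) :
    psupp (restrictPl η X) = psupp η ∩ X := by
  ext p
  simp only [mem_psupp, restrictPl_apply, Finset.mem_inter]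
  by_cases hp : p ∈ X <;> simp [hp]

omit [Fintype A] in
/-- Restriction to the support changes nothing; more generally to any superset of it. [folklore] -/
theorem restrictPl_eq_self {η : Plaquette d L → A} {X : Finset (Plaquette d L)} (h : psupp η ⊆ X) :
    restrictPl η X = η := by
  funext p
  rw [restrictPl_apply]
  split_ifs with hp
  · rfl
  · by_contra hne
    exact hp (h (mem_psupp.2 (Ne.symm hne)))

omit [Fintype A] in
/-- A configuration supported in `X ∪ Y` is the sum of its restrictions (disjoint `X, Y`). [folklore] -/
theorem restrictPl_add_restrictPl {η : Plaquette d L → A} {X Y : Finset (Plaquette d L)}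
    (hXY : Disjoint X Y) (h : psupp η ⊆ X ∪ Y) : restrictPl η X + restrictPl η Y = η := by
  funext p
  simp only [Pi.add_apply, restrictPl_apply]
  by_cases hpX : p ∈ X
  · have hpY : p ∉ Y := Finset.disjoint_left.1 hXY hpX
    simp [hpX, hpY]
  · by_cases hpY : p ∈ Y
    · simp [hpX, hpY]
    · simp only [hpX, hpY, if_false, add_zero]
      by_contra hne
      have := h (mem_psupp.2 (Ne.symm hne))
      rw [Finset.mem_union] at this
      tauto

omit [Fintype A] in
/-- Restricting a sum with disjoint supports to the support of the first summand. [folklore] -/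
theorem restrictPl_add_left {η₁ η₂ : Plaquette d L → A} {X Y : Finset (Plaquette d L)}
    (hXY : Disjoint X Y) (h₁ : psupp η₁ = X) (h₂ : psupp η₂ = Y) : restrictPl (η₁ + η₂) X = η₁ := by
  funext p
  rw [restrictPl_apply]
  split_ifs with hp
  · have : η₂ p = 0 := by
      by_contra hne
      exact Finset.disjoint_left.1 hXY hp (h₂ ▸ mem_psupp.2 hne)
    rw [Pi.add_apply, this, add_zero]
  · by_contra hne
    exact hp (h₁ ▸ mem_psupp.2 (Ne.symm hne))

omit [Fintype A] in
/-- Restricting a sum with disjoint supports to the support of the second summand. [folklore] -/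
theorem restrictPl_add_right {η₁ η₂ : Plaquette d L → A} {X Y : Finset (Plaquette d L)}
    (hXY : Disjoint X Y) (h₁ : psupp η₁ = X) (h₂ : psupp η₂ = Y) : restrictPl (η₁ + η₂) Y = η₂ := by
  rw [add_comm]
  exact restrictPl_add_left hXY.symm h₂ h₁

omit [Fintype A] in
/-- The Gibbs factor is multiplicative over disjoint supports (`φ 0 = 1`). [folklore] -/
theorem Wt_add_of_disjoint {φ : A → ℝ} (hφ0 : φ 0 = 1) {η₁ η₂ : Plaquette d L → A}
    (h : Disjoint (psupp η₁) (psupp η₂)) : Wt φ (η₁ + η₂) = Wt φ η₁ * Wt φ η₂ := by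
  rw [Wt_eq_prod_psupp hφ0, Wt_eq_prod_psupp hφ0, Wt_eq_prod_psupp hφ0, psupp_add_of_disjoint h,
    Finset.prod_union h]
  congr 1
  · refine Finset.prod_congr rfl fun p hp => ?_
    have : η₂ p = 0 := by
      by_contra hne; exact Finset.disjoint_left.1 h hp (mem_psupp.2 hne)
    rw [Pi.add_apply, this, add_zero]
  · refine Finset.prod_congr rfl fun p hp => ?_
    have : η₁ p = 0 := by
      by_contra hne; exact Finset.disjoint_left.1 h (mem_psupp.2 hne) hp
    rw [Pi.add_apply, this, zero_add]

/-! ### The two-block factorisation -/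

/-- Two plaquette sets are *separated* if no plaquette of the one is cube-adjacent to a plaquette
of the other (with disjointness: the sets are geometrically compatible). [folklore] -/
def Separated (X Y : Finset (Plaquette d L)) : Prop := ∀ f ∈ X, ∀ g ∈ Y, ¬ CubeAdj f g

omit [Fintype A] in
/-- Restricting a closed configuration supported in `X ∪ Y`, `X, Y` separated, to `X` gives a
closed configuration (face-saturation: a `3`-cell with a face in `X` has no face in `Y`). [folklore] -/
theorem isClosedPl_restrictPl_of_separated {η : Plaquette d L → A} (hη : IsClosedPl η)
    {X Y : Finset (Plaquette d L)} (hsep : Separated X Y) (hsupp : psupp η ⊆ X ∪ Y) :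
    IsClosedPl (restrictPl η X) := by
  refine isClosedPl_restrictPl hη fun x i j k hij hjk f hf g hg hfX hg0 => ?_
  have hgXY := hsupp (mem_psupp.2 hg0)
  rcases Finset.mem_union.1 hgXY with h | h
  · exact h
  · exact absurd ⟨x, i, j, k, hij, hjk, hf, hg⟩ (hsep f hfX g h)

/-- **Two-block factorisation.** For disjoint separated plaquette sets `X, Y` and a function `F`
of configurations multiplicative over disjoint supports, the sum of `F` over the closed
configurations supported exactly on `X ∪ Y` is the product of the sums over the fibres of `X`
and `Y` (the bijection `η ↦ (η|_X, η|_Y)`, `(η₁, η₂) ↦ η₁ + η₂`). [folklore] -/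
theorem sum_Fib_union {X Y : Finset (Plaquette d L)} (hXY : Disjoint X Y) (hsep : Separated X Y)
    (F : (Plaquette d L → A) → ℂ)
    (hF : ∀ η₁ η₂ : Plaquette d L → A, Disjoint (psupp η₁) (psupp η₂) → F (η₁ + η₂) = F η₁ * F η₂) :
    ∑ η ∈ Fib (X ∪ Y), F η = (∑ η₁ ∈ Fib X, F η₁) * ∑ η₂ ∈ Fib Y, F η₂ := by
  rw [Finset.sum_mul_sum, ← Finset.sum_product']
  symm
  refine Finset.sum_nbij' (fun pr => pr.1 + pr.2) (fun η => (restrictPl η X, restrictPl η Y))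
    ?_ ?_ ?_ ?_ ?_
  · -- into the big fibre
    rintro ⟨η₁, η₂⟩ hpr
    simp only [Finset.mem_product, mem_Fib] at hpr ⊢
    obtain ⟨⟨hc₁, hs₁⟩, ⟨hc₂, hs₂⟩⟩ := hpr
    have hdis : Disjoint (psupp η₁) (psupp η₂) := by rwa [hs₁, hs₂]
    exact ⟨hc₁.add hc₂, by rw [psupp_add_of_disjoint hdis, hs₁, hs₂]⟩
  · -- into the product of fibres
    intro η hη
    simp only [Finset.mem_product, mem_Fib] at hη ⊢
    obtain ⟨hc, hs⟩ := hη
    refine ⟨⟨isClosedPl_restrictPl_of_separated hc hsep hs.le, ?_⟩,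
      ⟨isClosedPl_restrictPl_of_separated hc (Y := X) (fun f hf g hg h => hsep g hg f hf (cubeAdj_symm h))
        (by rw [Finset.union_comm]; exact hs.le), ?_⟩⟩
    · rw [psupp_restrictPl, hs, Finset.union_inter_cancel_left]
    · rw [psupp_restrictPl, hs, Finset.union_inter_cancel_right]
  · -- left inverse
    rintro ⟨η₁, η₂⟩ hpr
    simp only [Finset.mem_product, mem_Fib] at hpr
    obtain ⟨⟨-, hs₁⟩, ⟨-, hs₂⟩⟩ := hpr
    simp only [restrictPl_add_left hXY hs₁ hs₂, restrictPl_add_right hXY hs₁ hs₂]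
  · -- right inverse
    intro η hη
    simp only [mem_Fib] at hη
    exact restrictPl_add_restrictPl hXY hη.2.le
  · -- weights
    rintro ⟨η₁, η₂⟩ hpr
    simp only [Finset.mem_product, mem_Fib] at hpr
    obtain ⟨⟨-, hs₁⟩, ⟨-, hs₂⟩⟩ := hpr
    exact (hF η₁ η₂ (by rwa [hs₁, hs₂])).symm

/-! ### Factorisation over the components and the polymer representation -/

omit [NeZero L] in
/-- Distinct components of a plaquette set are disjoint and separated. [folklore] -/
theorem disjoint_and_separated_of_mem_rcomponents {Q C C' : Finset (Plaquette d L)}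
    (hC : C ∈ rcomponents CubeAdj Q) (hC' : C' ∈ rcomponents CubeAdj Q) (hne : C ≠ C') :
    Disjoint C C' ∧ Separated C C' := by
  obtain ⟨p, hp, rfl⟩ := Literature.Probability.LatticeModels.mem_rcomponents_iff.1 hC
  obtain ⟨p', hp', rfl⟩ := Literature.Probability.LatticeModels.mem_rcomponents_iff.1 hC'
  have key : ¬ Touches CubeAdj (rcomponent CubeAdj Q p) (rcomponent CubeAdj Q p') := fun h =>
    hne (Literature.Probability.LatticeModels.eq_of_touches_rcomponent (fun _ _ => cubeAdj_symm) h)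
  constructor
  · rw [Finset.disjoint_left]
    intro q hq hq'
    exact key ⟨q, hq, q, hq', Or.inl rfl⟩
  · intro f hf g hg hfg
    exact key ⟨f, hf, g, hg, Or.inr hfg⟩

/-- **Factorisation over the components.** For a function of configurations multiplicative over
disjoint supports, the sum over the closed configurations supported exactly on `Q` is the
product over the cube-connected components `C` of `Q` of the sums over the fibres of `C`. [folklore] -/
theorem sum_Fib_eq_prod_rcomponents (F : (Plaquette d L → A) → ℂ) (hF0 : F 0 = 1)
    (hF : ∀ η₁ η₂ : Plaquette d L → A, Disjoint (psupp η₁) (psupp η₂) → F (η₁ + η₂) = F η₁ * F η₂)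
    (Q : Finset (Plaquette d L)) :
    ∑ η ∈ Fib Q, F η = ∏ C ∈ rcomponents CubeAdj Q, ∑ η ∈ Fib C, F η := by
  -- the fibre of `∅` is `{0}`
  have hFib0 : Fib (∅ : Finset (Plaquette d L)) = ({0} : Finset (Plaquette d L → A)) := by
    ext η
    simp only [mem_Fib, Finset.mem_singleton]
    constructor
    · rintro ⟨-, hs⟩
      funext p
      by_contra hne
      have : p ∈ psupp η := mem_psupp.2 hne
      rw [hs] at this
      exact absurd this (Finset.notMem_empty p)
    · rintro rfl
      exact ⟨isClosedPl_zero, by ext p; simp [psupp]⟩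
  -- induction over sub-families of components
  have key : ∀ 𝒞 : Finset (Finset (Plaquette d L)), 𝒞 ⊆ rcomponents CubeAdj Q →
      ∑ η ∈ Fib (𝒞.biUnion id), F η = ∏ C ∈ 𝒞, ∑ η ∈ Fib C, F η := by
    intro 𝒞
    induction 𝒞 using Finset.induction_on with
    | empty =>
      intro _
      rw [Finset.biUnion_empty, Finset.prod_empty, hFib0, Finset.sum_singleton, hF0]
    | insert C 𝒞 hC ih =>
      intro hsub
      have hCmem : C ∈ rcomponents CubeAdj Q := hsub (Finset.mem_insert_self C 𝒞)
      have hsub' : 𝒞 ⊆ rcomponents CubeAdj Q := fun C' hC' => hsub (Finset.mem_insert_of_mem hC')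
      rw [Finset.biUnion_insert, Finset.prod_insert hC, ← ih hsub', id]
      -- `C` and the union of the others are disjoint and separated
      have hpair : ∀ C' ∈ 𝒞, Disjoint C C' ∧ Separated C C' := fun C' hC' =>
        disjoint_and_separated_of_mem_rcomponents hCmem (hsub' hC') (fun h => hC (h ▸ hC'))
      refine sum_Fib_union ?_ ?_ F hF
      · rw [Finset.disjoint_biUnion_right]
        exact fun C' hC' => (hpair C' hC').1
      · intro f hf g hg
        obtain ⟨C', hC', hg'⟩ := Finset.mem_biUnion.1 hg
        exact (hpair C' hC').2 f hf g hg'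
  have h := key (rcomponents CubeAdj Q) le_rfl
  rwa [Literature.Probability.LatticeModels.biUnion_rcomponents] at h

/-- The family of cube-connected plaquette sets of the torus: the polymers of the contour gas.
[folklore] -/
def connSets (d L : ℕ) [NeZero L] : Finset (Finset (Plaquette d L)) :=
  by classical exact (Finset.univ : Finset (Finset (Plaquette d L))).filter fun X => IsRConnected CubeAdj X

omit [Fintype A] [DecidableEq A] in
/-- Membership in `connSets`. [folklore] -/
@[simp] theorem mem_connSets {X : Finset (Plaquette d L)} : X ∈ connSets d L ↔ IsRConnected CubeAdj X := by
  classical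
  simp [connSets]

/-- The closed configurations are partitioned by their supports into the fibres. [folklore] -/
theorem filter_Closed_psupp_eq (Q : Finset (Plaquette d L)) :
    (Closed d L A).filter (fun η => psupp η = Q) = Fib Q := by
  ext η; simp [Closed, Fib]

omit [Fintype A] in
/-- The Gibbs factor, as a complex number, times a multiplicative observable is multiplicative over
disjoint supports. [folklore] -/
theorem wt_mul_obs_mult {φ : A → ℝ} (hφ0 : φ 0 = 1) {ψ : (Plaquette d L → A) → ℂ} (hψ : IsMultObs ψ)
    (η₁ η₂ : Plaquette d L → A) (h : Disjoint (psupp η₁) (psupp η₂)) :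
    (Wt φ (η₁ + η₂) : ℂ) * ψ (η₁ + η₂) = ((Wt φ η₁ : ℂ) * ψ η₁) * ((Wt φ η₂ : ℂ) * ψ η₂) := by
  rw [Wt_add_of_disjoint hφ0 h, hψ.2 η₁ η₂ h]
  push_cast
  ring

omit [Fintype A] [DecidableEq A] in
/-- `Wt 0 = 1`. [folklore] -/
@[simp] theorem Wt_zero {φ : A → ℝ} (hφ0 : φ 0 = 1) : Wt φ (0 : Plaquette d L → A) = 1 := by
  simp [Wt, hφ0]

/-- **The polymer (contour) representation.** For single-plaquette weights with `φ 0 = 1` and a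
multiplicative observable `ψ`,
`∑_{η closed} Wt(η) ψ(η) = Ξ(connected sets; GeomInc CubeAdj; z_ψ)` — the partition function of the
hard-core gas of cube-connected plaquette sets with the dressed activities `act φ ψ`
(Friedli–Velenik §5.2: configurations ↔ compatible families of polymers, with factorising weights;
here via `sum_Fib_eq_prod_rcomponents` and `sum_powerset_prod_rcomponents`). [cite: FriedliVelenik2017, §5.2 (polymer representations)] -/
theorem sum_closed_eq_polymerPartitionFunction {φ : A → ℝ} (hφ0 : φ 0 = 1)
    {ψ : (Plaquette d L → A) → ℂ} (hψ : IsMultObs ψ) :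
    ∑ η ∈ Closed d L A, (Wt φ η : ℂ) * ψ η =
      polymerPartitionFunction (GeomInc CubeAdj) (act φ ψ) (connSets d L) := by
  set F : (Plaquette d L → A) → ℂ := fun η => (Wt φ η : ℂ) * ψ η with hF
  have hF0 : F 0 = 1 := by simp [hF, Wt_zero hφ0, hψ.1]
  have hFmult := wt_mul_obs_mult hφ0 hψ
  calc ∑ η ∈ Closed d L A, F η
      = ∑ Q ∈ (Finset.univ : Finset (Plaquette d L)).powerset,
          ∑ η ∈ (Closed d L A).filter (fun η => psupp η = Q), F η := by
        rw [Finset.sum_fiberwise_of_maps_to]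
        intro η _
        exact Finset.mem_powerset.2 (Finset.subset_univ _)
    _ = ∑ Q ∈ (Finset.univ : Finset (Plaquette d L)).powerset,
          ∏ C ∈ rcomponents CubeAdj Q, act φ ψ C := by
        refine Finset.sum_congr rfl fun Q _ => ?_
        rw [filter_Closed_psupp_eq, sum_Fib_eq_prod_rcomponents F hF0 hFmult]
        refine Finset.prod_congr rfl fun C hC => ?_
        obtain ⟨p, hp, rfl⟩ := Literature.Probability.LatticeModels.mem_rcomponents_iff.1 hC
        classical
        rw [act, if_pos (Literature.Probability.LatticeModels.isRConnected_rcomponent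
          (fun _ _ => cubeAdj_symm) hp)]
    _ = polymerPartitionFunction (GeomInc CubeAdj) (act φ ψ) (connSets d L) := by
        rw [Literature.Probability.LatticeModels.sum_powerset_prod_rcomponents (fun _ _ => cubeAdj_symm)]
        rw [connSets, Finset.powerset_univ]

/-! ### Activity bounds -/

/-- A fibre has at most `|A|^{#X}` elements (its members are determined by their values on `X`).
[folklore] -/
theorem card_Fib_le (X : Finset (Plaquette d L)) :
    (Fib X : Finset (Plaquette d L → A)).card ≤ Fintype.card A ^ X.card := by
  have h := Finset.card_le_card_of_injOn (s := Fib X) (t := (Finset.univ : Finset (↥X → A)))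
    (fun η : Plaquette d L → A => fun p : ↥X => η p) (fun _ _ => Finset.mem_coe.2 (Finset.mem_univ _))
    (by
      intro η hη η' hη' h
      simp only [Finset.mem_coe, mem_Fib] at hη hη'
      funext p
      by_cases hp : p ∈ X
      · exact congrFun h ⟨p, hp⟩
      · have h1 : η p = 0 := by
          by_contra hne; exact hp (hη.2 ▸ mem_psupp.2 hne)
        have h2 : η' p = 0 := by
          by_contra hne; exact hp (hη'.2 ▸ mem_psupp.2 hne)
        rw [h1, h2])
  simpa [Fintype.card_fun] using h

omit [AddCommGroup A] [Fintype A] [DecidableEq A] in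
/-- Gibbs factors are non-negative. [folklore] -/
theorem Wt_nonneg {φ : A → ℝ} (hφ : ∀ a, 0 ≤ φ a) (η : Plaquette d L → A) : 0 ≤ Wt φ η :=
  Finset.prod_nonneg fun _ _ => hφ _

omit [Fintype A] in
/-- **Peierls estimate for one configuration**: `Wt(η) ≤ ε^{#supp η}` when `φ ≤ ε` off `0`.
[folklore] -/
theorem Wt_le_pow {φ : A → ℝ} (hφ0 : φ 0 = 1) (hφ : ∀ a, 0 ≤ φ a) {ε : ℝ}
    (hε : ∀ a, a ≠ 0 → φ a ≤ ε) (η : Plaquette d L → A) : Wt φ η ≤ ε ^ (psupp η).card := by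
  rw [Wt_eq_prod_psupp hφ0, ← Finset.prod_const]
  exact Finset.prod_le_prod (fun p _ => hφ _) fun p hp => hε _ (mem_psupp.1 hp)

omit [Fintype A] in
/-- Off the cube-connected sets the activity vanishes. [folklore] -/
theorem act_eq_zero_of_not_isRConnected {φ : A → ℝ} {ψ : (Plaquette d L → A) → ℂ}
    {X : Finset (Plaquette d L)} (h : ¬ IsRConnected CubeAdj X) :
    ∀ [Fintype A], act φ ψ X = 0 := by
  intro _
  classical
  simp [act, h]

/-- **The activity bound** `‖z_ψ X‖ ≤ (|A| ε)^{#X}` for weights `φ ≤ ε` off `0` and observables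
`|ψ| ≤ 1`. [folklore] -/
theorem norm_act_le {φ : A → ℝ} (hφ0 : φ 0 = 1) (hφ : ∀ a, 0 ≤ φ a) {ε : ℝ} (hε0 : 0 ≤ ε)
    (hε : ∀ a, a ≠ 0 → φ a ≤ ε) {ψ : (Plaquette d L → A) → ℂ} (hψ : ∀ η, ‖ψ η‖ ≤ 1)
    (X : Finset (Plaquette d L)) : ‖act φ ψ X‖ ≤ ((Fintype.card A : ℝ) * ε) ^ X.card := by
  classical
  unfold act
  split_ifs with hc
  · calc ‖∑ η ∈ Fib X, (Wt φ η : ℂ) * ψ η‖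
        ≤ ∑ η ∈ Fib X, ‖(Wt φ η : ℂ) * ψ η‖ := norm_sum_le _ _
      _ ≤ ∑ η ∈ Fib X, ε ^ X.card := Finset.sum_le_sum fun η hη => by
          rw [norm_mul, Complex.norm_real, Real.norm_eq_abs, abs_of_nonneg (Wt_nonneg hφ η)]
          calc Wt φ η * ‖ψ η‖ ≤ Wt φ η * 1 :=
                mul_le_mul_of_nonneg_left (hψ η) (Wt_nonneg hφ η)
            _ ≤ ε ^ X.card := by
                rw [mul_one, ← (mem_Fib.1 hη).2]
                exact Wt_le_pow hφ0 hφ hε η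
      _ = (Fib X : Finset (Plaquette d L → A)).card * ε ^ X.card := by
          rw [Finset.sum_const, nsmul_eq_mul]
      _ ≤ (Fintype.card A : ℝ) ^ X.card * ε ^ X.card := by
          gcongr
          exact_mod_cast card_Fib_le X
      _ = ((Fintype.card A : ℝ) * ε) ^ X.card := by rw [mul_pow]
  · rw [norm_zero]; positivity

/-! ### The Kotecký–Preiss condition -/

/-- The degree constant of cube adjacency (`card_cubeNbr_le`). [folklore] -/
def cubeDeg (d : ℕ) : ℕ := 6 * ((d + 1) * d ^ 3)

omit [NeZero L] [Fintype A] [DecidableEq A] in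
/-- `Touches CubeAdj` is symmetric. [folklore] -/
theorem touches_cubeAdj_symm {X Y : Finset (Plaquette d L)} (h : Touches CubeAdj X Y) :
    Touches CubeAdj Y X := by
  obtain ⟨x, hx, y, hy, hxy⟩ := h
  exact ⟨y, hy, x, hx, hxy.imp Eq.symm cubeAdj_symm⟩

/-- **The Kotecký–Preiss condition for the contour gas** with size functions `a(X) = #X`,
`d(X) = τ #X`: if `λ = |A| ε e^{1+τ}` satisfies `(Δ+1)² λ ≤ 1/2` (`Δ = cubeDeg d`), then for
every finite plaquette set `W`, `∑_{Y ι W} ‖z_ψ Y‖ e^{#Y + τ #Y} ≤ #W` (the sum over all polymers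
geometrically incompatible with `W`; lattice-animal bound `sum_kpWeight_le_of_touches`).
[cite: KoteckyPreiss1986, (1) (the convergence condition)] -/
theorem kp_act {φ : A → ℝ} (hφ0 : φ 0 = 1) (hφ : ∀ a, 0 ≤ φ a) {ε : ℝ} (hε0 : 0 ≤ ε)
    (hε : ∀ a, a ≠ 0 → φ a ≤ ε) {ψ : (Plaquette d L → A) → ℂ} (hψ : ∀ η, ‖ψ η‖ ≤ 1)
    {τ : ℝ} (hsmall : ((cubeDeg d : ℝ) + 1) ^ 2 * ((Fintype.card A : ℝ) * ε * Real.exp (1 + τ)) ≤ 1 / 2)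
    (W : Finset (Plaquette d L)) [DecidablePred fun Y : Finset (Plaquette d L) => GeomInc CubeAdj Y W] :
    ∑ Y ∈ (Finset.univ : Finset (Finset (Plaquette d L))).filter (fun Y => GeomInc CubeAdj Y W),
        ‖act φ ψ Y‖ * Real.exp ((Y.card : ℝ) + τ * Y.card) ≤ W.card := by
  set lam : ℝ := (Fintype.card A : ℝ) * ε * Real.exp (1 + τ) with hlam_def
  have hlam : 0 ≤ lam := by positivity
  -- each term is at most the geometric KP weight
  have hterm : ∀ Y : Finset (Plaquette d L),
      ‖act φ ψ Y‖ * Real.exp ((Y.card : ℝ) + τ * Y.card) ≤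
        Literature.Probability.LatticeModels.kpWeight CubeAdj lam Y := by
    intro Y
    unfold Literature.Probability.LatticeModels.kpWeight
    split_ifs with hc
    · calc ‖act φ ψ Y‖ * Real.exp ((Y.card : ℝ) + τ * Y.card)
          ≤ ((Fintype.card A : ℝ) * ε) ^ Y.card * Real.exp ((Y.card : ℝ) + τ * Y.card) :=
            mul_le_mul_of_nonneg_right (norm_act_le hφ0 hφ hε0 hε hψ Y) (Real.exp_nonneg _)
        _ = lam ^ Y.card := by
            rw [show (Y.card : ℝ) + τ * Y.card = Y.card * (1 + τ) by ring, Real.exp_nat_mul, hlam_def,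
              mul_pow ((Fintype.card A : ℝ) * ε) (Real.exp (1 + τ)) Y.card]
    · rw [act_eq_zero_of_not_isRConnected hc, norm_zero, zero_mul]
  refine (Finset.sum_le_sum fun Y _ => hterm Y).trans ?_
  have hΔ : ∀ p : Plaquette d L, (cubeNbr p).card ≤ cubeDeg d := fun p => card_cubeNbr_le p
  have h := Literature.Probability.LatticeModels.sum_kpWeight_le_of_touches (R := CubeAdj)
    (nbr := cubeNbr) (Δ := cubeDeg d) (fun _ _ => cubeAdj_symm) hΔ (fun _ _ h => mem_cubeNbr_of_cubeAdj h)
    hlam hsmall W ((Finset.univ : Finset (Finset (Plaquette d L))).filter fun Y => GeomInc CubeAdj Y W)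
    (fun Y hY => by
      rcases (Finset.mem_filter.1 hY).2 with h | h
      · exact Or.inl h
      · exact Or.inr (touches_cubeAdj_symm h))
  refine h.trans ?_
  -- `2 (Δ + 1) λ ≤ 1`
  have hΔ1 : (1 : ℝ) ≤ (cubeDeg d : ℝ) + 1 := by
    have : (0 : ℝ) ≤ cubeDeg d := Nat.cast_nonneg _
    linarith
  have h2 : ((cubeDeg d : ℝ) + 1) * (2 * lam) ≤ 1 := by nlinarith [hsmall, hlam]
  calc (W.card : ℝ) * ((cubeDeg d : ℝ) + 1) * (2 * lam) = W.card * (((cubeDeg d : ℝ) + 1) * (2 * lam)) := by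
        ring
    _ ≤ W.card * 1 := mul_le_mul_of_nonneg_left h2 (Nat.cast_nonneg _)
    _ = W.card := mul_one _

/-! ### Components: restriction and the Peierls bound for large components -/

omit [Fintype A] in
/-- A component of the support is saturated for cube adjacency inside the support: a support
plaquette cube-adjacent to the component belongs to it. [folklore] -/
theorem mem_of_cubeAdj_of_mem_rcomponents {η : Plaquette d L → A} {X : Finset (Plaquette d L)}
    (hX : X ∈ rcomponents CubeAdj (psupp η)) {f g : Plaquette d L} (hf : f ∈ X) (hg : g ∈ psupp η)
    (hfg : CubeAdj f g) : g ∈ X := by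
  obtain ⟨p, hp, rfl⟩ := Literature.Probability.LatticeModels.mem_rcomponents_iff.1 hX
  obtain ⟨hfQ, hpf⟩ := Literature.Probability.LatticeModels.mem_rcomponent.1 hf
  exact Literature.Probability.LatticeModels.mem_rcomponent.2 ⟨hg, hpf.tail ⟨hfg, hfQ, hg⟩⟩

omit [Fintype A] in
/-- A component and the rest of the support are separated. [folklore] -/
theorem separated_of_mem_rcomponents {η : Plaquette d L → A} {X : Finset (Plaquette d L)}
    (hX : X ∈ rcomponents CubeAdj (psupp η)) : Separated X (psupp η \ X) := by
  intro f hf g hg hfg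
  rw [Finset.mem_sdiff] at hg
  exact hg.2 (mem_of_cubeAdj_of_mem_rcomponents hX hf hg.1 hfg)

/-- **The restriction of a closed configuration to a component of its support lies in the fibre of
the component** (components of vortex configurations are closed vortices). [cite: ForsstromLenellsViklund2022, §5.2 Lemma 5.3 (p. 17; decomposition into irreducible/vortex parts — arXiv:2001.07453v4, the numbering of this file's other tags; = §4 Lemma 4.3, p. 12, of arXiv v3)] -/
theorem restrictPl_mem_Fib_of_mem_rcomponents {η : Plaquette d L → A} (hη : IsClosedPl η)
    {X : Finset (Plaquette d L)} (hX : X ∈ rcomponents CubeAdj (psupp η)) :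
    restrictPl η X ∈ Fib X := by
  rw [mem_Fib]
  have hXsub : X ⊆ psupp η := by
    obtain ⟨p, hp, rfl⟩ := Literature.Probability.LatticeModels.mem_rcomponents_iff.1 hX
    exact Literature.Probability.LatticeModels.rcomponent_subset _ _
  refine ⟨isClosedPl_restrictPl_of_separated hη (separated_of_mem_rcomponents hX) ?_, ?_⟩
  · intro p hp
    by_cases hpX : p ∈ X
    · exact Finset.mem_union_left _ hpX
    · exact Finset.mem_union_right _ (Finset.mem_sdiff.2 ⟨hp, hpX⟩)
  · rw [psupp_restrictPl, Finset.inter_eq_right.2 hXsub]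

omit [Fintype A] in
/-- The complementary restriction (to the support minus a component) is closed as well. [folklore] -/
theorem isClosedPl_restrictPl_sdiff_of_mem_rcomponents {η : Plaquette d L → A} (hη : IsClosedPl η)
    {X : Finset (Plaquette d L)} (hX : X ∈ rcomponents CubeAdj (psupp η)) :
    IsClosedPl (restrictPl η (psupp η \ X)) := by
  refine isClosedPl_restrictPl_of_separated hη (Y := X) ?_ ?_
  · intro f hf g hg hfg
    exact separated_of_mem_rcomponents hX g hg f hf (cubeAdj_symm hfg)
  · intro p hp
    by_cases hpX : p ∈ X
    · exact Finset.mem_union_right _ hpX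
    · exact Finset.mem_union_left _ (Finset.mem_sdiff.2 ⟨hp, hpX⟩)

/-- **Peierls bound for large vortices.** The total Gibbs weight of the closed configurations
having a cube-connected component with at least `M` plaquettes is at most the total closed weight
times `∑_{X connected, #X ≥ M} (|A| ε)^{#X}`: split such a configuration as
`η = η|_X + η|_{supp ∖ X}` over a big component `X` (both parts closed, the weight factorises) and
bound the weight of the fibre of `X` by `#Fib(X) ε^{#X} ≤ (|A| ε)^{#X}` (Friedli–Velenik §5.7,
"Peierls argument"; Marra–Miracle-Solé 1979 for the gauge invariant Ising model). [cite: FriedliVelenik2017, §5.7 (Peierls contours and their energy–entropy bound)] -/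
theorem sum_closed_bigComponent_le {φ : A → ℝ} (hφ0 : φ 0 = 1) (hφ : ∀ a, 0 ≤ φ a) {ε : ℝ}
    (hε0 : 0 ≤ ε) (hε : ∀ a, a ≠ 0 → φ a ≤ ε) (M : ℕ)
    [DecidablePred fun η : Plaquette d L → A => ∃ C ∈ rcomponents CubeAdj (psupp η), M ≤ C.card] :
    ∑ η ∈ (Closed d L A).filter (fun η => ∃ C ∈ rcomponents CubeAdj (psupp η), M ≤ C.card), Wt φ η ≤
      (∑ η ∈ Closed d L A, Wt φ η) *
        ∑ X ∈ (connSets d L).filter (fun X => M ≤ X.card), ((Fintype.card A : ℝ) * ε) ^ X.card := by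
  classical
  set Bad := (Closed d L A).filter fun η => ∃ C ∈ rcomponents CubeAdj (psupp η), M ≤ C.card
    with hBad
  set Big := (connSets d L).filter fun X => M ≤ X.card with hBig
  -- Step 1: union bound over the big component
  have h1 : ∑ η ∈ Bad, Wt φ η ≤ ∑ η ∈ Bad, ∑ X ∈ Big with X ∈ rcomponents CubeAdj (psupp η), Wt φ η := by
    refine Finset.sum_le_sum fun η hη => ?_
    obtain ⟨-, C, hC, hMC⟩ := Finset.mem_filter.1 hη
    have hCmem : C ∈ Big.filter fun X => X ∈ rcomponents CubeAdj (psupp η) := by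
      refine Finset.mem_filter.2 ⟨Finset.mem_filter.2 ⟨mem_connSets.2 ?_, hMC⟩, hC⟩
      obtain ⟨p, hp, rfl⟩ := Literature.Probability.LatticeModels.mem_rcomponents_iff.1 hC
      exact Literature.Probability.LatticeModels.isRConnected_rcomponent (fun _ _ => cubeAdj_symm) hp
    exact Finset.single_le_sum (f := fun _ => Wt φ η) (fun _ _ => Wt_nonneg hφ η) hCmem
  -- Step 2: exchange the sums and drop the badness condition
  have h2 : ∑ η ∈ Bad, ∑ X ∈ Big with X ∈ rcomponents CubeAdj (psupp η), Wt φ η ≤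
      ∑ X ∈ Big, ∑ η ∈ (Closed d L A) with X ∈ rcomponents CubeAdj (psupp η), Wt φ η := by
    rw [Finset.sum_comm' (t' := Big) (s' := fun X => Bad.filter fun η => X ∈ rcomponents CubeAdj (psupp η))
      (h := fun η X => by simp only [Finset.mem_filter]; tauto)]
    refine Finset.sum_le_sum fun X _ => Finset.sum_le_sum_of_subset_of_nonneg ?_ fun η _ _ => Wt_nonneg hφ η
    intro η hη
    simp only [Finset.mem_filter, hBad] at hη ⊢
    exact ⟨hη.1.1, hη.2⟩
  -- Step 3: for a fixed big `X`, split over `X`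
  have h3 : ∀ X ∈ Big, ∑ η ∈ (Closed d L A) with X ∈ rcomponents CubeAdj (psupp η), Wt φ η ≤
      ((Fintype.card A : ℝ) * ε) ^ X.card * ∑ η ∈ Closed d L A, Wt φ η := by
    intro X hX
    set S := (Closed d L A).filter fun η => X ∈ rcomponents CubeAdj (psupp η) with hS
    set i : (Plaquette d L → A) → (Plaquette d L → A) × (Plaquette d L → A) :=
      fun η => (restrictPl η X, restrictPl η (psupp η \ X)) with hi
    have hsum : ∀ η ∈ S, (i η).1 + (i η).2 = η := fun η _ =>
      restrictPl_add_restrictPl Finset.disjoint_sdiff (by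
        intro p hp; by_cases hpX : p ∈ X
        · exact Finset.mem_union_left _ hpX
        · exact Finset.mem_union_right _ (Finset.mem_sdiff.2 ⟨hp, hpX⟩))
    have hinj : Set.InjOn i S := fun η hη η' hη' h => by
      rw [← hsum η hη, ← hsum η' hη', h]
    have hmaps : ∀ η ∈ S, i η ∈ Fib X ×ˢ Closed d L A := by
      intro η hη
      obtain ⟨hηc, hXc⟩ := Finset.mem_filter.1 hη
      rw [mem_Closed] at hηc
      exact Finset.mem_product.2 ⟨restrictPl_mem_Fib_of_mem_rcomponents hηc hXc,
        mem_Closed.2 (isClosedPl_restrictPl_sdiff_of_mem_rcomponents hηc hXc)⟩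
    have hwt : ∀ η ∈ S, Wt φ η = Wt φ (i η).1 * Wt φ (i η).2 := by
      intro η hη
      conv_lhs => rw [← hsum η hη]
      refine Wt_add_of_disjoint hφ0 ?_
      rw [psupp_restrictPl, psupp_restrictPl]
      exact Finset.disjoint_of_subset_left Finset.inter_subset_right
        (Finset.disjoint_of_subset_right Finset.inter_subset_right Finset.disjoint_sdiff)
    set g : (Plaquette d L → A) × (Plaquette d L → A) → ℝ := fun pr => Wt φ pr.1 * Wt φ pr.2 with hg
    calc ∑ η ∈ S, Wt φ η = ∑ η ∈ S, g (i η) := Finset.sum_congr rfl hwt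
      _ = ∑ pr ∈ S.image i, g pr := by
          rw [Finset.sum_image fun x hx y hy h => hinj hx hy h]
      _ ≤ ∑ pr ∈ Fib X ×ˢ Closed d L A, g pr :=
          Finset.sum_le_sum_of_subset_of_nonneg (fun pr hpr => by
            obtain ⟨η, hη, rfl⟩ := Finset.mem_image.1 hpr
            exact hmaps η hη) fun pr _ _ => mul_nonneg (Wt_nonneg hφ _) (Wt_nonneg hφ _)
      _ = (∑ η₁ ∈ Fib X, Wt φ η₁) * ∑ η₂ ∈ Closed d L A, Wt φ η₂ := by
          rw [hg, Finset.sum_product, Finset.sum_mul_sum]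
      _ ≤ ((Fintype.card A : ℝ) * ε) ^ X.card * ∑ η ∈ Closed d L A, Wt φ η := by
          refine mul_le_mul_of_nonneg_right ?_ (Finset.sum_nonneg fun η _ => Wt_nonneg hφ η)
          calc ∑ η₁ ∈ Fib X, Wt φ η₁ ≤ ∑ η₁ ∈ Fib X, ε ^ X.card := Finset.sum_le_sum fun η hη => by
                rw [← (mem_Fib.1 hη).2]; exact Wt_le_pow hφ0 hφ hε η
            _ = (Fib X : Finset (Plaquette d L → A)).card * ε ^ X.card := by
                rw [Finset.sum_const, nsmul_eq_mul]
            _ ≤ (Fintype.card A : ℝ) ^ X.card * ε ^ X.card := by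
                gcongr; exact_mod_cast card_Fib_le X
            _ = ((Fintype.card A : ℝ) * ε) ^ X.card := by rw [mul_pow]
  calc ∑ η ∈ Bad, Wt φ η ≤ _ := h1
    _ ≤ _ := h2
    _ ≤ ∑ X ∈ Big, ((Fintype.card A : ℝ) * ε) ^ X.card * ∑ η ∈ Closed d L A, Wt φ η := Finset.sum_le_sum h3
    _ = (∑ η ∈ Closed d L A, Wt φ η) * ∑ X ∈ Big, ((Fintype.card A : ℝ) * ε) ^ X.card := by
        rw [Finset.mul_sum]; refine Finset.sum_congr rfl fun X _ => ?_; ring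

/-! ### Closed configurations with small components are plaquette fields -/

omit [NeZero L] [Fintype A] [DecidableEq A] in
/-- A non-zero value of `ext η` sits on a support plaquette with the same base point. [folklore] -/
theorem exists_mem_psupp_of_ext_ne_zero [NeZero L] [DecidableEq A] {η : Plaquette d L → A}
    {x : Site d L} {i j : Fin d} (h : ext η x i j ≠ 0) : ∃ p ∈ psupp η, p.1 = x := by
  unfold ext at h
  split_ifs at h with hij hji
  · exact ⟨_, mem_psupp.2 h, rfl⟩
  · exact ⟨_, mem_psupp.2 (neg_ne_zero.1 h), rfl⟩
  · exact absurd rfl h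

omit [NeZero L] [Fintype A] [DecidableEq A] in
/-- `td₁` of a finite sum of `1`-cochains. [folklore] -/
theorem td₁_sum {ι : Type*} (s : Finset ι) (θ : ι → Site d L → Fin d → A) :
    td₁ (∑ c ∈ s, θ c) = ∑ c ∈ s, td₁ (θ c) := by
  classical
  induction s using Finset.induction_on with
  | empty => funext x i j; simp [td₁]
  | insert a s ha ih => rw [Finset.sum_insert ha, Finset.sum_insert ha, td₁_add, ih]

omit [Fintype A] in
/-- A configuration is the sum of its restrictions to the components of its support. [folklore] -/
theorem sum_rcomponents_restrictPl (η : Plaquette d L → A) :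
    ∑ C ∈ rcomponents CubeAdj (psupp η), restrictPl η C = η := by
  funext p
  rw [Finset.sum_apply]
  by_cases hp : p ∈ psupp η
  · -- exactly one component contains `p`
    have hCp : rcomponent CubeAdj (psupp η) p ∈ rcomponents CubeAdj (psupp η) :=
      Literature.Probability.LatticeModels.mem_rcomponents_iff.2 ⟨p, hp, rfl⟩
    rw [← Finset.add_sum_erase _ _ hCp, restrictPl_apply,
      if_pos (Literature.Probability.LatticeModels.mem_rcomponent_self hp)]
    have : ∑ C ∈ (rcomponents CubeAdj (psupp η)).erase (rcomponent CubeAdj (psupp η) p),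
        restrictPl η C p = 0 := by
      refine Finset.sum_eq_zero fun C hC => ?_
      obtain ⟨hCne, hC⟩ := Finset.mem_erase.1 hC
      rw [restrictPl_apply, if_neg]
      intro hpC
      obtain ⟨q, hq, rfl⟩ := Literature.Probability.LatticeModels.mem_rcomponents_iff.1 hC
      exact hCne (Literature.Probability.LatticeModels.rcomponent_eq_of_mem (fun _ _ => cubeAdj_symm) hpC).symm
    rw [this, add_zero]
  · have h0 : η p = 0 := by simpa using hp
    rw [h0]
    refine Finset.sum_eq_zero fun C hC => ?_
    rw [restrictPl_apply, if_neg]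
    intro hpC
    obtain ⟨q, hq, rfl⟩ := Literature.Probability.LatticeModels.mem_rcomponents_iff.1 hC
    exact hp (Literature.Probability.LatticeModels.rcomponent_subset _ _ hpC)

/-- **A closed vortex configuration all of whose components are small is exact.** On `(ℤ/Lℤ)^d`,
`d ≥ 3`: if every cube-connected component `C` of the support of the closed configuration `η`
has `2 #C < L`, then `ext η = td₁ θ` for some `1`-cochain `θ` (translate each component away from
the seam, `exists_shift_away`; apply `exists_td₁_eq_of_liftBox`; translate back and add up).
[cite: ForsstromLenellsViklund2022, §2.3.3 (Lemma 2.2) with §5.2 (vortex decompositions; arXiv v4 numbering)] -/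
theorem exists_td₁_eq_ext_of_small (hd : 3 ≤ d) {η : Plaquette d L → A} (hη : IsClosedPl η)
    (hsmall : ∀ C ∈ rcomponents CubeAdj (psupp η), 2 * C.card < L) :
    ∃ θ : Site d L → Fin d → A, td₁ θ = ext η := by
  -- one primitive per component
  have hcomp : ∀ C ∈ rcomponents CubeAdj (psupp η), ∃ θ : Site d L → Fin d → A,
      td₁ θ = ext (restrictPl η C) := by
    intro C hC
    set ηC := restrictPl η C with hηC
    have hηCfib := restrictPl_mem_Fib_of_mem_rcomponents hη hC
    rw [mem_Fib] at hηCfib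
    obtain ⟨hcl, hsupp⟩ := hηCfib
    -- translate the base points of `C` away from the seam
    set S : Finset (Site d L) := C.image Prod.fst with hS
    have hScard : 2 * S.card < L := lt_of_le_of_lt (Nat.mul_le_mul_left 2 Finset.card_image_le) (hsmall C hC)
    obtain ⟨v, hv⟩ := exists_shift_away S hScard
    set ω := shiftCochain₂ v (ext ηC) with hω
    have hωalt : IsAlt ω := (isAlt_ext ηC).shiftCochain₂ v
    have hωcl : ∀ y i j k, td₂ ω y i j k = 0 := fun y i j k => by
      rw [hω, td₂_shiftCochain₂]; exact hcl _ i j k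
    have hbox : LiftBox ω (fun _ => (1 : ℤ)) (fun _ => (L : ℤ) - 2) := by
      refine ⟨fun _ => le_rfl, fun _ => le_rfl, fun y i j hy => ?_⟩
      obtain ⟨p, hp, hp1⟩ := exists_mem_psupp_of_ext_ne_zero hy
      rw [hηC, hsupp] at hp
      have hmemS : y + v ∈ S := Finset.mem_image.2 ⟨p, hp, hp1⟩
      refine ⟨fun m => ?_, fun m => ?_⟩
      · have h := (hv (y + v) hmemS m)
        rw [Pi.add_apply, add_sub_cancel_right] at h
        exact (val_mem_of_ne h.1 h.2).1
      · have h := (hv (y + v) hmemS m)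
        rw [Pi.add_apply, add_sub_cancel_right] at h
        exact (val_mem_of_ne h.1 h.2).2
    obtain ⟨θ', hθ', -⟩ := exists_td₁_eq_of_liftBox hd hωalt hωcl hbox
    refine ⟨shiftCochain₁ (-v) θ', ?_⟩
    rw [td₁_shiftCochain₁, hθ', hω, shiftCochain₂_neg_shiftCochain₂]
  choose! θ hθ using hcomp
  refine ⟨∑ C ∈ rcomponents CubeAdj (psupp η), θ C, ?_⟩
  rw [td₁_sum, Finset.sum_congr rfl hθ, ← ext_sum, sum_rcomponents_restrictPl]

end LatticeForm

/-- **Small closed vortex configurations are plaquette fields of link configurations** (abelian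
gauge group `G`, `d ≥ 3`): if every cube-connected component `C` of the support of the closed
configuration `η : Plaquette d L → Additive G` has `2 #C < L`, then `η = plaqField U` for some
`U : GaugeConfig d L G`. [cite: ForsstromLenellsViklund2022, §2.3.3 (Lemma 2.2, the Poincaré lemma)] -/
theorem exists_plaqField_eq_of_small {d L : ℕ} [NeZero L] {G : Type*} [CommGroup G] [Fintype G]
    [DecidableEq G] (hd : 3 ≤ d) {η : Plaquette d L → Additive G} (hη : LatticeForm.IsClosedPl η)
    (hsmall : ∀ C ∈ rcomponents LatticeForm.CubeAdj (LatticeForm.psupp η), 2 * C.card < L) :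
    ∃ U : GaugeConfig d L G, plaqField U = η := by
  classical
  obtain ⟨θ, hθ⟩ := LatticeForm.exists_td₁_eq_ext_of_small hd hη hsmall
  refine ⟨fun e => Additive.toMul (θ e.1 e.2), ?_⟩
  have hlink : linkField (fun e : Edge d L => Additive.toMul (θ e.1 e.2)) = θ := by
    funext x i; simp [linkField]
  rw [plaqField, hlink, hθ, LatticeForm.res_ext]

end Literature.MathematicalPhysics.QuantumFieldTheory

end
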